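/-
Copyright (c) 2026 the pub-hodgecm-mathlib formalisation cell (harness21).  Prover seat hodgecm-mathlib-K2E4-p10 (g5), Track B ∕ K2-LIT, h413 =
`stmt-HodgeConjecture-24833`, ENGINE E4, ROW J payer road item 19 of the dealer-planner K2E4-plan (g3): CAPACITY answer 2026-09-04T08:02:04Z + HEADS memo
`K2/K2E4-plan/g3/heads/HEADS-RowJ-items0-19.K2E4-plan-g3.lean` (sha16 d860d535bb707081) heads (h19a) (h19b), statements verbatim.
-/
import Summits.HodgeConjecture.HodgeConjecture.Theorems.F0P3XiArchPacketUnitary          -- ★ `isCohUnitaryClass_πn_archPacketOfRecord`, `JInfCohUnitary`, `DsInfCohUnitary`; cone: ★ `IsCohUnitaryClass`, `archPacketOfRecord`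
import Summits.HodgeConjecture.HodgeConjecture.Theorems.K2E1bCarriersOfRecord             -- ★ #23 `jInfOfRecord`, `dsInfOfRecord`, `jRepOfRecord_package`, `dsRepOfRecord_package`, `tableOfRecord`
import Literature.NumberTheory.Automorphic.HasUnitaryGlobalizationOfInfUnitaryU21          -- ★ `hasUnitaryGlobalization_of_isInfUnitary_uTwoOne` (Harish-Chandra ∕ Knapp–Vogan 0.6 (a), PROVED at `U(2,1)`)
import Literature.NumberTheory.Automorphic.GKInfinitesimallyUnitaryConverse                -- ★ `isInfUnitary_of_isInfUnitaryAlongP` (six clauses ⇒ Borel–Wallach unitarity at `U(2,1)`)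
import Literature.NumberTheory.Automorphic.UnitaryGroupArchCharacter                       -- ★ `HasUnitaryGlobalization`
import HarnessLib

/-!
# K2·E4 — `K2E4ArchGlobalizationOfRecord` (ROW J item 19): THE TWO `HasUnitaryGlobalization` GUARDS OF ROW J HOLD FOR THE RECORD TABLE — NO HYPOTHESIS

Track B ∕ K2-LIT, crux h413 = `stmt-HodgeConjecture-24833`, route of record `HCCMUnconditional`; cell `hodgecm-mathlib`, squad K2, ENGINE E4 (dealer-planner
K2E4-plan (g3), research row J `sig_K2E4ArchCharIdentityOfRecord`, payer-road item 19).  Prover seat `hodgecm-mathlib-K2E4-p10` (g5).  THEOREMS ONLY (no `def`, no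
`instance`, no notation, no named-fact hypothesis, no `sorry`); lane `--supports stmt-HodgeConjecture-24833 --as helper` (count-neutral).  Closes no socket.

THE MATHEMATICS [KnappVogan1995, Introduction Thm. 0.6 (a); HarishChandra1953, Thms. 8–9; BorelWallach2000, 0 §2.5; Rogawski1990, §12.3 pp. 176–178].
ROW J (`sig_K2E4ArchCharIdentityOfRecord`) guards its archimedean character identity by `HasUnitaryGlobalization (uFormGroup (Fin 2) (Fin 1)) x` for `x = πⁿ(ξ_ι)` and
for `πˢ(ξ_ι) = some x` of the archimedean packet of record ★ `archPacketOfRecord ι μω jInfOfRecord dsInfOfRecord ξ` — the non-junk guard of ★ `UnitaryGroup.archTr₀`.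
Both guards are THEOREMS: (h19a) a coh-unitary class (★ `IsCohUnitaryClass x`: the class of an irreducible ADMISSIBLE `(𝔲(2,1), K)`-module unitary along
`𝔭 ⊕ ℝz₀`) has a unitary globalization — the six clauses give Borel–Wallach infinitesimal unitarity (★ `isInfUnitary_of_isInfUnitaryAlongP`), and an admissible
infinitesimally unitary irreducible `(𝔤, K)`-module of `U(2,1)` globalizes unitarily (Harish-Chandra ∕ Knapp–Vogan Thm. 0.6 (a), ★
`hasUnitaryGlobalization_of_isInfUnitary_uTwoOne`, PROVED in the tree); (h19b) every member of the record packet is coh-unitary: `πⁿ` on the cohomological locus is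
`[J^{±}]` (★ `isCohUnitaryClass_archDegOneClass`), off it `jInfOfRecord p q t = [jRepOfRecord p q t]` (★ `jRepOfRecord_package`), and `πˢ = some (dsInfOfRecord p q t)`
(★ `archPacketOfRecord_πs`, `rfl`) with ★ `dsRepOfRecord_package`.

THE LEAN TEXT.  §1 the record carriers satisfy the two residual clauses of ★ `F0P3XiArchPacketUnitary`: `jInfCohUnitary_jInfOfRecord : JInfCohUnitary jInfOfRecord`,
`dsInfCohUnitary_dsInfOfRecord : DsInfCohUnitary dsInfOfRecord` (so every ★ lemma there is hypothesis-free at the table of record); §2 the dealt head (h19a)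
**`hasUnitaryGlobalization_of_isCohUnitaryClass (x) (hx : IsCohUnitaryClass x) : HasUnitaryGlobalization (uFormGroup (Fin 2) (Fin 1)) x`**; §3 the dealt head (h19b)
**`hasUnitaryGlobalization_archPacketOfRecord (L ι μω ξ) : HasUnitaryGlobalization … (archPacketOfRecord ι μω jInfOfRecord dsInfOfRecord ξ).πn ∧
∀ y, (…).πs = some y → HasUnitaryGlobalization … y`** + the member form `hasUnitaryGlobalization_of_mem_archPacketOfRecord` and the carrier forms
`hasUnitaryGlobalization_jInfOfRecord ∕ _dsInfOfRecord`.  Statements (h19a)(h19b) VERBATIM from the HEADS memo.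
HONEST LABEL: HC_CM is proved only modulo the 7 printed citations (2 remaining named inputs: hLiu418 = `stmt-HodgeConjecture-24832`, h413 = `stmt-HodgeConjecture-24833`)
until rung 0 closes; this file asserts no named fact and closes no socket.
References: [KnappVogan1995] Introduction Thm. 0.6 (a) · [HarishChandra1953] Thms. 8–9 · [BorelWallach2000] 0 §2.5 · [Rogawski1990] §12.3 pp. 176–178, Prop. 13.8.1 p. 206.
-/

set_option autoImplicit false
-- the mandated namespace repeats the single-problem summit's segment (`HodgeConjecture.HodgeConjecture`)
set_option linter.dupNamespace false

noncomputable section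

open NumberField
open Literature.NumberTheory.Automorphic Literature.NumberTheory.Rogawski1990
open Literature.RepresentationTheory.KonnoKonno2007
open Summit.HodgeConjecture.HodgeConjecture.Cruxes.H413.K2E1bCarriersOfRecord (jInfOfRecord dsInfOfRecord jRepOfRecord dsRepOfRecord
  jRepOfRecord_package dsRepOfRecord_package tableOfRecord)
open Summit.HodgeConjecture.HodgeConjecture.Cruxes.H413.F0P3XiArchPacketOfRecord (archPacketOfRecord archPacketOfRecord_πs mem_archPacketOfRecord_iff)
open Summit.HodgeConjecture.HodgeConjecture.Cruxes.H413.F0P3UnitaryLocOfRecord (IsCohUnitaryClass isCohUnitaryClass_mk)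
open Summit.HodgeConjecture.HodgeConjecture.Cruxes.H413.F0P3XiArchPacketUnitary (JInfCohUnitary DsInfCohUnitary isCohUnitaryClass_πn_archPacketOfRecord
  isCohUnitaryClass_of_mem_archPacketOfRecord)
open scoped Matrix MatrixGroups

namespace Summit.HodgeConjecture.HodgeConjecture.Cruxes.H413.K2E4ArchGlobalizationOfRecord

/-! ## §1 The record carriers are coh-unitary: the two residual clauses of ★ `F0P3XiArchPacketUnitary` hold at `jInfOfRecord`, `dsInfOfRecord` -/

/-- **`jInfOfRecord p q t = [jRepOfRecord p q t]` is coh-unitary** for ALL `p q t` (★ `jRepOfRecord_package`: the representative is an irreducible admissible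
`(𝔲(2,1), K)`-module unitary along `𝔭 ⊕ ℝz₀`). [cite: Rogawski1990, §12.3 pp. 176–178] [cite: BorelWallach2000, VI Thm. 4.12 (2)] -/
theorem isCohUnitaryClass_jInfOfRecord (p q t : ℤ) : IsCohUnitaryClass (jInfOfRecord p q t) :=
  isCohUnitaryClass_mk (jRepOfRecord_package p q t).1

/-- **`dsInfOfRecord p q t = [dsRepOfRecord p q t]` is coh-unitary** (★ `dsRepOfRecord_package`). [cite: Rogawski1990, §12.3 pp. 177–178] [cite: BorelWallach2000, VI Thm. 4.12 (2)] -/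
theorem isCohUnitaryClass_dsInfOfRecord (p q t : ℤ) : IsCohUnitaryClass (dsInfOfRecord p q t) :=
  isCohUnitaryClass_mk (dsRepOfRecord_package p q t).1

/-- The clause ★ `JInfCohUnitary` holds for the `J`-carrier of record (indeed on AND off the cohomological locus). [cite: Rogawski1990, §12.3 p. 176] -/
theorem jInfCohUnitary_jInfOfRecord : JInfCohUnitary jInfOfRecord :=
  fun p q t _ => isCohUnitaryClass_jInfOfRecord p q t

/-- The clause ★ `DsInfCohUnitary` holds for the square-integrable carrier of record. [cite: Rogawski1990, §12.3 p. 177] -/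
theorem dsInfCohUnitary_dsInfOfRecord : DsInfCohUnitary dsInfOfRecord :=
  fun p q t => isCohUnitaryClass_dsInfOfRecord p q t

/-- The same two clauses read off the fields of ★ `tableOfRecord` (`tableOfRecord.jInf = jInfOfRecord`, `tableOfRecord.dsInf = dsInfOfRecord`, both `rfl`).
[cite: Rogawski1990, §12.3 pp. 176–178] -/
theorem cohUnitary_tableOfRecord : JInfCohUnitary tableOfRecord.jInf ∧ DsInfCohUnitary tableOfRecord.dsInf :=
  ⟨jInfCohUnitary_jInfOfRecord, dsInfCohUnitary_dsInfOfRecord⟩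

/-! ## §2 The dealt head (h19a): a coh-unitary class has a unitary globalization (Harish-Chandra ∕ Knapp–Vogan 0.6 (a) at `U(2,1)`) -/

/-- **ROW J item 19 (generic bridge) — `IsCohUnitaryClass x → HasUnitaryGlobalization (uFormGroup (Fin 2) (Fin 1)) x`, NO HYPOTHESIS.**  Take the representative
`r` with `[r] = x` and `IsCohUnitaryIrrep r.ρK r.ρ𝔤` (`.gk`, `.adm`, `.unit`); the six clauses `.unit` give Borel–Wallach infinitesimal unitarity
(★ `isInfUnitary_of_isInfUnitaryAlongP`), and Harish-Chandra's globalization theorem at `U(2,1)` (★ `hasUnitaryGlobalization_of_isInfUnitary_uTwoOne`, PROVED in the tree)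
gives the unitary Hilbert globalization — the idiom of ★ `K2E1bDSRecordLawGlob.hasUnitaryGlobalization_dsCellRep`.
[cite: KnappVogan1995, Introduction Thm. 0.6 (a)] [cite: HarishChandra1953, Thms. 8–9] [cite: BorelWallach2000, 0 §2.5] -/
theorem hasUnitaryGlobalization_of_isCohUnitaryClass (x : GKIrrClass (uFormGroup (Fin 2) (Fin 1))) (hx : IsCohUnitaryClass x) :
    HasUnitaryGlobalization (uFormGroup (Fin 2) (Fin 1)) x := by
  obtain ⟨r, rfl, h⟩ := hx
  exact hasUnitaryGlobalization_of_isInfUnitary_uTwoOne r h.adm (isInfUnitary_of_isInfUnitaryAlongP h.gk h.unit)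

/-- `jInfOfRecord p q t` has a unitary globalization. [cite: KnappVogan1995, Introduction Thm. 0.6 (a)] [cite: Rogawski1990, §12.3 p. 178] -/
theorem hasUnitaryGlobalization_jInfOfRecord (p q t : ℤ) : HasUnitaryGlobalization (uFormGroup (Fin 2) (Fin 1)) (jInfOfRecord p q t) :=
  hasUnitaryGlobalization_of_isCohUnitaryClass _ (isCohUnitaryClass_jInfOfRecord p q t)

/-- `dsInfOfRecord p q t` has a unitary globalization. [cite: KnappVogan1995, Introduction Thm. 0.6 (a)] [cite: Rogawski1990, §12.3 pp. 177–178] -/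
theorem hasUnitaryGlobalization_dsInfOfRecord (p q t : ℤ) : HasUnitaryGlobalization (uFormGroup (Fin 2) (Fin 1)) (dsInfOfRecord p q t) :=
  hasUnitaryGlobalization_of_isCohUnitaryClass _ (isCohUnitaryClass_dsInfOfRecord p q t)

/-! ## §3 The dealt head (h19b): both ROW J guards at the archimedean packet of record, for every `L ι μω ξ` -/

section Record

variable (L : Type) [Field L] [NumberField L] [IsCMField L] (ι : L →+* ℂ)
  (μω : Literature.NumberTheory.GaloisRepresentations.HeckeCharacter L)

/-- **Every member of the archimedean packet of record has a unitary globalization** (★ `isCohUnitaryClass_of_mem_archPacketOfRecord` made hypothesis-free by §1,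
then (h19a)). [cite: Rogawski1990, §12.3 pp. 176–178; Prop. 13.8.1 p. 206] [cite: KnappVogan1995, Introduction Thm. 0.6 (a)] -/
theorem hasUnitaryGlobalization_of_mem_archPacketOfRecord (ξ : OneDimAutRepH L) {x : GKIrrClass (uFormGroup (Fin 2) (Fin 1))}
    (hx : x ∈ (archPacketOfRecord ι μω jInfOfRecord dsInfOfRecord ξ).members) : HasUnitaryGlobalization (uFormGroup (Fin 2) (Fin 1)) x :=
  hasUnitaryGlobalization_of_isCohUnitaryClass x
    (isCohUnitaryClass_of_mem_archPacketOfRecord jInfOfRecord dsInfOfRecord ι μω jInfCohUnitary_jInfOfRecord dsInfCohUnitary_dsInfOfRecord ξ hx)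

/-- `πⁿ(ξ_ι)` of record has a unitary globalization (★ `isCohUnitaryClass_πn_archPacketOfRecord` with the clause of §1).
[cite: Rogawski1990, §12.3 p. 176] [cite: KnappVogan1995, Introduction Thm. 0.6 (a)] -/
theorem hasUnitaryGlobalization_πn_archPacketOfRecord (ξ : OneDimAutRepH L) :
    HasUnitaryGlobalization (uFormGroup (Fin 2) (Fin 1)) (archPacketOfRecord ι μω jInfOfRecord dsInfOfRecord ξ).πn :=
  hasUnitaryGlobalization_of_isCohUnitaryClass _ (isCohUnitaryClass_πn_archPacketOfRecord jInfOfRecord dsInfOfRecord ι μω jInfCohUnitary_jInfOfRecord ξ)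

/-- **ROW J item 19 (at the record table) — BOTH `HasUnitaryGlobalization` GUARDS OF ROW J HOLD, for every CM field `L`, CM type `ι`, Hecke character `μω` and
`ξ : OneDimAutRepH L`:** `πⁿ(ξ_ι)` and every `y` with `πˢ(ξ_ι) = some y` (namely `y = dsInfOfRecord p q t`, ★ `archPacketOfRecord_πs`) have unitary globalizations.
[cite: Rogawski1990, §12.3 pp. 176–178] [cite: KnappVogan1995, Introduction Thm. 0.6 (a)] [cite: HarishChandra1953, Thms. 8–9] -/
theorem hasUnitaryGlobalization_archPacketOfRecord (ξ : OneDimAutRepH L) :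
    HasUnitaryGlobalization (uFormGroup (Fin 2) (Fin 1)) (archPacketOfRecord ι μω jInfOfRecord dsInfOfRecord ξ).πn ∧
      ∀ y : GKIrrClass (uFormGroup (Fin 2) (Fin 1)),
        (archPacketOfRecord ι μω jInfOfRecord dsInfOfRecord ξ).πs = some y → HasUnitaryGlobalization (uFormGroup (Fin 2) (Fin 1)) y := by
  refine ⟨hasUnitaryGlobalization_πn_archPacketOfRecord L ι μω ξ, fun y hy => ?_⟩
  rw [archPacketOfRecord_πs] at hy
  obtain rfl := Option.some.inj hy
  exact hasUnitaryGlobalization_dsInfOfRecord _ _ _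

end Record

end Summit.HodgeConjecture.HodgeConjecture.Cruxes.H413.K2E4ArchGlobalizationOfRecord

end
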